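import Summits.AtomisticToContinuum.Crystallization.Theorems.OverbindingBudgetAffineRunCutAxial

/-!
# `OverbindingBudget` / crux `RobustDefectLimitWindows` (stmt-AtomisticToContinuum-31280) — «RunCut»: the ODD MOMENT IDENTITIES of an offset layer (C₃ + mirror)

Support file (lens-4 g86, hand-in 3 part 0; memo `g86/memo/SW-G1.md` §9.7).  The chirality selection rule (`…RunCutChiralitySelect.
tsum_weight_quadForm_sq_sub`) consumes five odd in-plane moment identities of a weight `g` on the offset coset `{i u + j v + w}` (integer
coordinates `X = 2i + j + δ = 2x`, `Y = 3j + δ = 2√3·y`, pattern `δ ≤ 1` of the audited `StackingSums` kit): degree 1 — `Σ' gX = Σ' gY = 0`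
(`…RunCutAxial.c3_moment_x/_y`, C₃); degree 3 — `Σ' gX³ = Σ' gXY² = 0` and `Σ' gY³ = −3·Σ' gX²Y`.  The degree-3 ones need BOTH the threefold axis
(spin-1 parts `X(3X²+Y²)`, `Y(3X²+Y²)`: orbit sums vanish, Part A) AND the mirror `x ↦ −x` of the coset (`(i,j) ↦ (−i−j−δ, j)`: `X ↦ −X`, `Y ↦ Y`;
kills the spin-3 part `Re (x+iy)³ ∝ X³ − XY²`, Part B).  Part C combines them; Part D rescales to the metric coordinates `x = aX/2`, `y = aY/(2√3)` of
own scale `a`, in exactly the shape `tsum_weight_quadForm_sq_sub` takes.  Summability is carried as hypotheses (discharged in hand-in 3 by the kit's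
`summable_layerTerm_mul` pattern; the chirality weights are `layerTerm 1 5 (2/3)` / `layerTerm 1 8 (2/3)` combinations).
[this file: 2 definitions (`mirrorMap`, `mirrorEquiv`), 10 theorems; imports `…RunCutAxial`; standard axioms]
-/

namespace Summit.AtomisticToContinuum.Crystallization.Theorems.OverbindingBudgetAffineRunCutChiralityMoments

open Literature.MathematicalPhysics.StatisticalMechanics.StackingSums
open Summit.AtomisticToContinuum.Crystallization.Theorems.OverbindingBudgetAffineRunCutAxial

/-! ## Part A — C₃: the spin-1 cubic moments -/

/-- **`X·|q|²`-moment**: `∑' g·(2i+j+δ)·(3(2i+j+δ)² + (3j+δ)²) = 0` for a C₃-invariant weight (`3X² + Y² = 12Q_δ + 4δ² − 4δ` is invariant,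
the orbit sum of `X` vanishes). [this file · kind: proof] -/
theorem c3_moment_x_normSq {δ : ℕ} (g : ℤ × ℤ → ℝ) (hg : ∀ ij, g (c3Map δ ij) = g ij)
    (hs : Summable fun ij : ℤ × ℤ =>
      g ij * (3 * (2 * (ij.1 : ℝ) + ij.2 + δ) ^ 3 + (2 * (ij.1 : ℝ) + ij.2 + δ) * (3 * (ij.2 : ℝ) + δ) ^ 2)) :
    ∑' ij : ℤ × ℤ, g ij * (3 * (2 * (ij.1 : ℝ) + ij.2 + δ) ^ 3 + (2 * (ij.1 : ℝ) + ij.2 + δ) * (3 * (ij.2 : ℝ) + δ) ^ 2) = 0 :=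
  tsum_c3_moment_eq_zero g _ hg (fun ⟨i, j⟩ => by simp only [c3Map]; push_cast; ring) hs

/-- **`Y·|q|²`-moment**: `∑' g·(3(2i+j+δ)²(3j+δ) + (3j+δ)³) = 0` for a C₃-invariant weight. [this file · kind: proof] -/
theorem c3_moment_y_normSq {δ : ℕ} (g : ℤ × ℤ → ℝ) (hg : ∀ ij, g (c3Map δ ij) = g ij)
    (hs : Summable fun ij : ℤ × ℤ =>
      g ij * (3 * ((2 * (ij.1 : ℝ) + ij.2 + δ) ^ 2 * (3 * (ij.2 : ℝ) + δ)) + (3 * (ij.2 : ℝ) + δ) ^ 3)) :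
    ∑' ij : ℤ × ℤ, g ij * (3 * ((2 * (ij.1 : ℝ) + ij.2 + δ) ^ 2 * (3 * (ij.2 : ℝ) + δ)) + (3 * (ij.2 : ℝ) + δ) ^ 3) = 0 :=
  tsum_c3_moment_eq_zero g _ hg (fun ⟨i, j⟩ => by simp only [c3Map]; push_cast; ring) hs

/-! ## Part B — the mirror of the offset coset -/

/-- **The mirror** `x ↦ −x` on pattern indices: `(i, j) ↦ (−i − j − δ, j)` (`X ↦ −X`, `Y ↦ Y`). [this file · kind: definition] -/
def mirrorMap (δ : ℕ) (ij : ℤ × ℤ) : ℤ × ℤ :=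
  (-ij.1 - ij.2 - δ, ij.2)

/-- The mirror is an involution. [folklore] -/
theorem mirrorMap_mirrorMap (δ : ℕ) (ij : ℤ × ℤ) : mirrorMap δ (mirrorMap δ ij) = ij := by
  obtain ⟨i, j⟩ := ij
  refine Prod.ext ?_ rfl
  simp only [mirrorMap]
  ring

/-- **The mirror as a permutation of `ℤ²`.** [this file · kind: definition] -/
def mirrorEquiv (δ : ℕ) : ℤ × ℤ ≃ ℤ × ℤ where
  toFun := mirrorMap δ
  invFun := mirrorMap δ
  left_inv := mirrorMap_mirrorMap δ
  right_inv := mirrorMap_mirrorMap δ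

/-- The pattern form is mirror-invariant (a polynomial identity, every `δ`). [folklore] -/
theorem stackForm_mirrorMap (δ : ℕ) (ij : ℤ × ℤ) :
    stackForm δ (mirrorMap δ ij).1 (mirrorMap δ ij).2 = stackForm δ ij.1 ij.2 := by
  obtain ⟨i, j⟩ := ij
  simp only [mirrorMap, stackForm]
  push_cast
  ring

/-- The layer term is mirror-invariant. [folklore] -/
theorem layerTerm_mirrorMap (δ n : ℕ) (s : ℝ) (ij : ℤ × ℤ) : layerTerm δ n s (mirrorMap δ ij) = layerTerm δ n s ij := by
  unfold layerTerm; rw [stackForm_mirrorMap]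

/-- **Mirror cancellation**: a mirror-odd `f` has `∑' f = 0` (no summability needed). [folklore] -/
theorem tsum_eq_zero_of_mirror_odd {δ : ℕ} (f : ℤ × ℤ → ℝ) (h : ∀ ij, f (mirrorMap δ ij) = -f ij) : ∑' ij, f ij = 0 := by
  have e : ∑' ij, f (mirrorMap δ ij) = ∑' ij, f ij := (mirrorEquiv δ).tsum_eq f
  rw [tsum_congr h, tsum_neg] at e
  linarith

/-- **Mirror selection of the spin-3 cubic**: `∑' g·((2i+j+δ)³ − (2i+j+δ)(3j+δ)²) = 0` (`8·Re(x+iy)³ = X³ − XY²` is mirror-odd) for a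
mirror-invariant weight. [this file · kind: proof] -/
theorem mirror_moment_re3 {δ : ℕ} (g : ℤ × ℤ → ℝ) (hg : ∀ ij, g (mirrorMap δ ij) = g ij) :
    ∑' ij : ℤ × ℤ, g ij * ((2 * (ij.1 : ℝ) + ij.2 + δ) ^ 3 - (2 * (ij.1 : ℝ) + ij.2 + δ) * (3 * (ij.2 : ℝ) + δ) ^ 2) = 0 := by
  refine tsum_eq_zero_of_mirror_odd (δ := δ) _ fun ij => ?_
  rw [hg ij]
  obtain ⟨i, j⟩ := ij
  simp only [mirrorMap]
  push_cast
  ring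

/-! ## Part C — the five odd moment identities in integer coordinates -/

/-- ★ **Degree-3 identities, `X`-type**: for a C₃- and mirror-invariant weight, `∑' gX³ = 0` and `∑' gXY² = 0`. [this file · kind: proof] -/
theorem moments_x3_xy2 {δ : ℕ} (g : ℤ × ℤ → ℝ) (hg3 : ∀ ij, g (c3Map δ ij) = g ij) (hgm : ∀ ij, g (mirrorMap δ ij) = g ij)
    (s1 : Summable fun ij : ℤ × ℤ => g ij * (2 * (ij.1 : ℝ) + ij.2 + δ) ^ 3)
    (s2 : Summable fun ij : ℤ × ℤ => g ij * ((2 * (ij.1 : ℝ) + ij.2 + δ) * (3 * (ij.2 : ℝ) + δ) ^ 2)) :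
    ∑' ij : ℤ × ℤ, g ij * (2 * (ij.1 : ℝ) + ij.2 + δ) ^ 3 = 0
      ∧ ∑' ij : ℤ × ℤ, g ij * ((2 * (ij.1 : ℝ) + ij.2 + δ) * (3 * (ij.2 : ℝ) + δ) ^ 2) = 0 := by
  have hA : Summable fun ij : ℤ × ℤ =>
      g ij * (3 * (2 * (ij.1 : ℝ) + ij.2 + δ) ^ 3 + (2 * (ij.1 : ℝ) + ij.2 + δ) * (3 * (ij.2 : ℝ) + δ) ^ 2) := by
    have := (s1.mul_left 3).add s2
    refine this.congr fun ij => by ring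
  have A := c3_moment_x_normSq g hg3 hA
  have B := mirror_moment_re3 g hgm
  have eA : ∑' ij : ℤ × ℤ, g ij * (3 * (2 * (ij.1 : ℝ) + ij.2 + δ) ^ 3 + (2 * (ij.1 : ℝ) + ij.2 + δ) * (3 * (ij.2 : ℝ) + δ) ^ 2)
      = 3 * ∑' ij : ℤ × ℤ, g ij * (2 * (ij.1 : ℝ) + ij.2 + δ) ^ 3
        + ∑' ij : ℤ × ℤ, g ij * ((2 * (ij.1 : ℝ) + ij.2 + δ) * (3 * (ij.2 : ℝ) + δ) ^ 2) := by
    rw [← tsum_mul_left, ← (s1.mul_left 3).tsum_add s2]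
    exact tsum_congr fun ij => by ring
  have eB : ∑' ij : ℤ × ℤ, g ij * ((2 * (ij.1 : ℝ) + ij.2 + δ) ^ 3 - (2 * (ij.1 : ℝ) + ij.2 + δ) * (3 * (ij.2 : ℝ) + δ) ^ 2)
      = ∑' ij : ℤ × ℤ, g ij * (2 * (ij.1 : ℝ) + ij.2 + δ) ^ 3
        - ∑' ij : ℤ × ℤ, g ij * ((2 * (ij.1 : ℝ) + ij.2 + δ) * (3 * (ij.2 : ℝ) + δ) ^ 2) := by
    rw [← s1.tsum_sub s2]
    exact tsum_congr fun ij => by ring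
  rw [eA] at A
  rw [eB] at B
  constructor <;> linarith

/-- ★ **Degree-3 identity, `Y`-type**: for a C₃-invariant weight, `∑' gY³ = −3·∑' gX²Y`. [this file · kind: proof] -/
theorem moment_y3 {δ : ℕ} (g : ℤ × ℤ → ℝ) (hg3 : ∀ ij, g (c3Map δ ij) = g ij)
    (s3 : Summable fun ij : ℤ × ℤ => g ij * (3 * (ij.2 : ℝ) + δ) ^ 3)
    (s4 : Summable fun ij : ℤ × ℤ => g ij * ((2 * (ij.1 : ℝ) + ij.2 + δ) ^ 2 * (3 * (ij.2 : ℝ) + δ))) :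
    ∑' ij : ℤ × ℤ, g ij * (3 * (ij.2 : ℝ) + δ) ^ 3
      = -3 * ∑' ij : ℤ × ℤ, g ij * ((2 * (ij.1 : ℝ) + ij.2 + δ) ^ 2 * (3 * (ij.2 : ℝ) + δ)) := by
  have hA : Summable fun ij : ℤ × ℤ =>
      g ij * (3 * ((2 * (ij.1 : ℝ) + ij.2 + δ) ^ 2 * (3 * (ij.2 : ℝ) + δ)) + (3 * (ij.2 : ℝ) + δ) ^ 3) := by
    have := (s4.mul_left 3).add s3
    refine this.congr fun ij => by ring
  have A := c3_moment_y_normSq g hg3 hA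
  have eA : ∑' ij : ℤ × ℤ, g ij * (3 * ((2 * (ij.1 : ℝ) + ij.2 + δ) ^ 2 * (3 * (ij.2 : ℝ) + δ)) + (3 * (ij.2 : ℝ) + δ) ^ 3)
      = 3 * ∑' ij : ℤ × ℤ, g ij * ((2 * (ij.1 : ℝ) + ij.2 + δ) ^ 2 * (3 * (ij.2 : ℝ) + δ))
        + ∑' ij : ℤ × ℤ, g ij * (3 * (ij.2 : ℝ) + δ) ^ 3 := by
    rw [← tsum_mul_left, ← (s4.mul_left 3).tsum_add s3]
    exact tsum_congr fun ij => by ring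
  rw [eA] at A
  linarith

/-! ## Part D — metric coordinates of own scale `a`: `x = a·X/2`, `y = a·Y/(2√3)` -/

/-- ★ **THE FIVE ODD MOMENT IDENTITIES in metric coordinates** — exactly the hypotheses `m1x m1y m3xxx m3xyy m3yyy` of
`…RunCutChiralitySelect.tsum_weight_quadForm_sq_sub` for `x_q = a(2i+j+δ)/2`, `y_q = a(3j+δ)/(2√3)`. [this file · kind: proof] -/
theorem odd_moments_metric {δ : ℕ} (g : ℤ × ℤ → ℝ) (hg3 : ∀ ij, g (c3Map δ ij) = g ij) (hgm : ∀ ij, g (mirrorMap δ ij) = g ij)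
    (a : ℝ)
    (t1 : Summable fun ij : ℤ × ℤ => g ij * (2 * (ij.1 : ℝ) + ij.2 + δ))
    (t2 : Summable fun ij : ℤ × ℤ => g ij * (3 * (ij.2 : ℝ) + δ))
    (s1 : Summable fun ij : ℤ × ℤ => g ij * (2 * (ij.1 : ℝ) + ij.2 + δ) ^ 3)
    (s2 : Summable fun ij : ℤ × ℤ => g ij * ((2 * (ij.1 : ℝ) + ij.2 + δ) * (3 * (ij.2 : ℝ) + δ) ^ 2))
    (s3 : Summable fun ij : ℤ × ℤ => g ij * (3 * (ij.2 : ℝ) + δ) ^ 3)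
    (s4 : Summable fun ij : ℤ × ℤ => g ij * ((2 * (ij.1 : ℝ) + ij.2 + δ) ^ 2 * (3 * (ij.2 : ℝ) + δ))) :
    let x : ℤ × ℤ → ℝ := fun ij => a * (2 * (ij.1 : ℝ) + ij.2 + δ) / 2
    let y : ℤ × ℤ → ℝ := fun ij => a * (3 * (ij.2 : ℝ) + δ) / (2 * Real.sqrt 3)
    (∑' ij, g ij * x ij = 0) ∧ (∑' ij, g ij * y ij = 0) ∧ (∑' ij, g ij * x ij ^ 3 = 0)
      ∧ (∑' ij, g ij * (x ij * y ij ^ 2) = 0) ∧ (∑' ij, g ij * y ij ^ 3 = -∑' ij, g ij * (x ij ^ 2 * y ij)) := by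
  intro x y
  have h3 : (0 : ℝ) < Real.sqrt 3 := Real.sqrt_pos.2 (by norm_num)
  have hsq : Real.sqrt 3 ^ 2 = 3 := Real.sq_sqrt (by norm_num)
  have M1 := c3_moment_x g hg3 t1
  have M2 := c3_moment_y g hg3 t2
  obtain ⟨M3, M4⟩ := moments_x3_xy2 g hg3 hgm s1 s2
  have M5 := moment_y3 g hg3 s3 s4
  refine ⟨?_, ?_, ?_, ?_, ?_⟩
  · have : ∀ ij : ℤ × ℤ, g ij * x ij = (a / 2) * (g ij * (2 * (ij.1 : ℝ) + ij.2 + δ)) := fun ij => by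
      simp only [x]; ring
    rw [tsum_congr this, tsum_mul_left, M1, mul_zero]
  · have : ∀ ij : ℤ × ℤ, g ij * y ij = (a / (2 * Real.sqrt 3)) * (g ij * (3 * (ij.2 : ℝ) + δ)) := fun ij => by
      simp only [y]; ring
    rw [tsum_congr this, tsum_mul_left, M2, mul_zero]
  · have : ∀ ij : ℤ × ℤ, g ij * x ij ^ 3 = (a ^ 3 / 8) * (g ij * (2 * (ij.1 : ℝ) + ij.2 + δ) ^ 3) := fun ij => by
      simp only [x]; ring
    rw [tsum_congr this, tsum_mul_left, M3, mul_zero]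
  · have : ∀ ij : ℤ × ℤ, g ij * (x ij * y ij ^ 2)
        = (a ^ 3 / (8 * Real.sqrt 3 ^ 2)) * (g ij * ((2 * (ij.1 : ℝ) + ij.2 + δ) * (3 * (ij.2 : ℝ) + δ) ^ 2)) := fun ij => by
      simp only [x, y]
      field_simp
      ring
    rw [tsum_congr this, tsum_mul_left, M4, mul_zero]
  · have ey : ∀ ij : ℤ × ℤ, g ij * y ij ^ 3 = (a ^ 3 / (8 * Real.sqrt 3 ^ 3)) * (g ij * (3 * (ij.2 : ℝ) + δ) ^ 3) := fun ij => by
      simp only [y]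
      field_simp
      ring
    have exy : ∀ ij : ℤ × ℤ, g ij * (x ij ^ 2 * y ij)
        = (a ^ 3 / (8 * Real.sqrt 3)) * (g ij * ((2 * (ij.1 : ℝ) + ij.2 + δ) ^ 2 * (3 * (ij.2 : ℝ) + δ))) := fun ij => by
      simp only [x, y]
      field_simp
      ring
    rw [tsum_congr ey, tsum_congr exy, tsum_mul_left, tsum_mul_left, M5]
    have e3 : Real.sqrt 3 ^ 3 = 3 * Real.sqrt 3 := by rw [pow_succ, hsq]
    rw [e3]
    field_simp
    try ring

end Summit.AtomisticToContinuum.Crystallization.Theorems.OverbindingBudgetAffineRunCutChiralityMoments
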